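import Summits.ResolutionOfSingularities.ResolutionOfSingularities.Theorems.PurelyInseparableDim4PhiLineUFreePart
import Summits.ResolutionOfSingularities.ResolutionOfSingularities.Theorems.PurelyInseparableDim4PhiLineConeBridge
import HarnessLib

/-!
# (K-Φ2) chain dictionary XIV: THE DEPARTURE LABEL — reading the binary label form `Ψ` off a state whose `y`-rows annihilate the vertex

Cell `res-dim4-pi` (D-0157 DOOR 2), Φ = β_h line (CARD I-1-8; B∞ assembly skeleton of res-dim4-p-12 — STUBS E/K/L, asked by res-dim4-p-2 g5 (q3)).
Converse companion of (K-Φ2) XIII: if `e_G = finrank (resVertex s) = 2` and the two `y`-rows of the carried invertible frame `A` annihilate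
`resVertex s`, then `in_d G = Ψ(y-rows)` for a binary form `Ψ` of degree `d` with `A(Ψ) = 0`, and `G = Ψ(y-rows) + Q`, `Q ∈ 𝔪₀^{d+1}` — the inputs
`hH₀`/`hΨ`/`hΨA` of (K-Φ2) VII `chartTransform_translate_label` and X `exists_label_readaptation_of_step`. Route (DEF-FREE): `A(in_d σ_B G) = A·resVertex s
⊆ {v_y = 0}` (`𝕎(σ_B S) = B⁻¹ 𝕎(S)`, tame degree `d < p`), equality by `e_G = 2` ⇒ `e_{u₁}, e_{u₂} ∈ A(in_d σ_B G)` ⇒ `∂_u in_d σ_B G = 0` ⇒ `u`-free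
((K-Φ3) III, `d < p`) ⇒ `in_d σ_B G = rename castAdd Ψ` ⇒ pull back by `σ_A`.

[OURS · counted 0 · AI work weaker than expert review.] Nothing here proves K2(p), the β_h line, or resolution of singularities in dimension ≥ 4 /
characteristic p.

Sources: V. Cossart, U. Jannsen, S. Saito (2020) Def. 1.26, Lemma 12.2 [`CossartJannsenSaito2020`]; V. Cossart, O. Piltant, J. Algebra 320 (2008)
proof of Prop. 4.2 [`CossartPiltant2008`].
-/

set_option linter.dupNamespace false

noncomputable section

namespace Summit.ResolutionOfSingularities.ResolutionOfSingularities.Theorems.PIDim4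

namespace PhiLine

open MvPolynomial Finset IsLocalRing
open Literature.AlgebraicGeometry.Resolution
open Literature.AlgebraicGeometry.Resolution.Hauser2010
open Literature.AlgebraicGeometry.Resolution.WeightedOrder
open Literature.AlgebraicGeometry.Resolution.PointBlowup (additiveSubspace)

variable {K : Type} [Field K]

/-- **THE DEPARTURE LABEL.** For a presented state `s.F = x^{s.r}·G` with `ord₀ G = d < p`, an invertible carried frame `A` (`A B = 1 = B A`),
`e_G = 2`, and `y`-rows annihilating `resVertex s`: `G = Ψ(y-rows of A) + Q` with `Ψ` a binary form of degree `d`, `A(Ψ) = 0`, `Q ∈ 𝔪₀^{d+1}`.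
[cite: CossartJannsenSaito2020, Def. 1.26, Lemma 12.2] [cite: CossartPiltant2008, proof of Prop. 4.2] -/
theorem exists_label_of_yRows_annihilate (p : ℕ) [CharP K p] {d : ℕ} (hdp : d < p) {s : State K} {G : MvPolynomial (Fin 4) K}
    (hF : s.F = monomial s.r 1 * G) (hd : ordZero G = d) {A B : Matrix (Fin 4) (Fin 4) K} (hAB : A * B = 1) (hBA : B * A = 1)
    (he : Module.finrank K (ResCone.resVertex s) = 2)
    (hy : ∀ i : Fin (2 + 2), i ≠ u1 2 → i ≠ u2 2 → ∀ w ∈ ResCone.resVertex s, ∑ t, A i t * w t = 0) :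
    ∃ Ψ : MvPolynomial (Fin 2) K, Ψ.IsHomogeneous d ∧ (∀ w ∈ additiveSubspace Ψ, w = 0) ∧
      ∃ Q ∈ Literature.AlgebraicGeometry.Resolution.originIdeal K 4 ^ (d + 1),
        G = aeval (fun k : Fin 2 => ∑ t, C (A (Fin.castAdd 2 k) t) * X t) Ψ + Q := by
  classical
  set ΦG := homogeneousComponent d G with hΦG
  set Φ := linSubst K B ΦG with hΦ
  have hΦGhom : ΦG.IsHomogeneous d := homogeneousComponent_isHomogeneous d G
  have hΦhom : Φ.IsHomogeneous d := isHomogeneous_linSubst B hΦGhom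
  have h1 : ΦG.totalDegree < p := lt_of_le_of_lt hΦGhom.totalDegree_le hdp
  have h2 : Φ.totalDegree < p := lt_of_le_of_lt hΦhom.totalDegree_le hdp
  have hu1U : u1 2 ∈ ({u1 2, u2 2} : Finset (Fin (2 + 2))) := Finset.mem_insert_self _ _
  have hu2U : u2 2 ∈ ({u1 2, u2 2} : Finset (Fin (2 + 2))) := Finset.mem_insert_of_mem (Finset.mem_singleton_self _)
  -- (1) `A(Φ) ⊆ {v : v_y = 0}`: `v ∈ A(σ_B ΦG) ⇒ B·v ∈ A(ΦG) = resVertex s ⇒ (A·B·v)_y = v_y = 0`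
  have hAV : ∀ v ∈ additiveSubspace Φ, ∀ k : Fin 2, v (Fin.castAdd 2 k) = 0 := by
    intro v hv k
    have hBv : B.mulVec v ∈ ResCone.resVertex s := by
      rw [resVertex_eq_additiveSubspace hF hd, additiveSubspace_eq_invarianceSpace p h1]
      rw [hΦ, additiveSubspace_eq_invarianceSpace p h2, ← Set.image_singleton, mem_invarianceSpace_image_linSubst_iff K hBA] at hv
      exact hv
    have h : (A.mulVec (B.mulVec v)) (Fin.castAdd 2 k) = 0 := hy (Fin.castAdd 2 k) (castAdd_ne_u1 k) (castAdd_ne_u2 k) _ hBv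
    rwa [Matrix.mulVec_mulVec, hAB, Matrix.one_mulVec] at h
  -- (2) `dim A(Φ) = e_G = 2 = dim {v_y = 0}` ⇒ equality ⇒ `e_{u₁}, e_{u₂} ∈ A(Φ)` ⇒ `∂_u Φ = 0`
  set π : (Fin (2 + 2) → K) →ₗ[K] (Fin 2 → K) := LinearMap.funLeft K K (Fin.castAdd 2 : Fin 2 → Fin (2 + 2)) with hπ
  have hle : additiveSubspace Φ ≤ LinearMap.ker π := fun v hv => by
    rw [LinearMap.mem_ker]; funext k; rw [hπ, LinearMap.funLeft_apply, Pi.zero_apply]; exact hAV v hv k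
  have hfin : Module.finrank K (additiveSubspace Φ) = 2 := by
    rw [hΦ, finrank_additiveSubspace_linSubst p hBA hAB hΦGhom hdp, hΦG, ← resVertex_eq_additiveSubspace hF hd, he]
  have hker : Module.finrank K (LinearMap.ker π) = 2 := by
    have h := LinearMap.finrank_range_add_finrank_ker π
    rw [LinearMap.range_eq_top.mpr (LinearMap.funLeft_surjective_of_injective K K _ (Fin.castAdd_injective 2 2)), finrank_top,
      Module.finrank_fin_fun K, Module.finrank_fin_fun K] at h
    omega
  have hEq : additiveSubspace Φ = LinearMap.ker π := Submodule.eq_of_le_of_finrank_eq hle (by rw [hker, hfin])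
  have hpd : ∀ u ∈ ({u1 2, u2 2} : Finset (Fin (2 + 2))), pderiv u Φ = 0 := by
    intro u hu
    have hne : ∀ k : Fin 2, Fin.castAdd 2 k ≠ u := by
      intro k
      rcases Finset.mem_insert.mp hu with rfl | hu'
      · exact castAdd_ne_u1 k
      · rw [Finset.mem_singleton] at hu'; rw [hu']; exact castAdd_ne_u2 k
    have hmem : (Pi.single u (1 : K) : Fin (2 + 2) → K) ∈ additiveSubspace Φ := by
      rw [hEq, LinearMap.mem_ker]
      funext k
      rw [hπ, LinearMap.funLeft_apply, Pi.zero_apply, Pi.single_apply, if_neg (hne k)]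
    rw [mem_additiveSubspace_iff_sum_smul_pderiv, Finset.sum_eq_single u (fun i _ hi => by rw [Pi.single_eq_of_ne hi, zero_smul])
      (fun h => absurd (Finset.mem_univ u) h), Pi.single_eq_same, one_smul] at hmem
    exact hmem
  -- (3) `Φ` is `u`-free (tame degree) ⇒ `Φ = rename castAdd Ψ`
  have hfree : ∀ m ∈ Φ.support, ∀ u ∈ ({u1 2, u2 2} : Finset (Fin (2 + 2))), m u = 0 := fun m hm u hu =>
    eq_zero_of_pderiv_eq_zero_of_apply_lt p (hpd u hu) (fun m' hm' => apply_lt_of_isHomogeneous_of_lt hΦhom hdp hm' u) hm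
  have hvars : ↑Φ.vars ⊆ Set.range (Fin.castAdd 2 : Fin 2 → Fin (2 + 2)) := by
    intro i hi
    rw [Finset.mem_coe, mem_vars_iff_mem_support] at hi
    obtain ⟨m, hm, him⟩ := hi
    rw [Finsupp.mem_support_iff] at him
    induction i using Fin.addCases with
    | left k => exact ⟨k, rfl⟩
    | right j =>
      exfalso; apply him
      fin_cases j
      · exact hfree m hm (u1 2) hu1U
      · exact hfree m hm (u2 2) hu2U
  obtain ⟨Ψ, hΨ⟩ := exists_rename_eq_of_vars_subset_range Φ (Fin.castAdd 2) (Fin.castAdd_injective 2 2) hvars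
  have hΨhom : Ψ.IsHomogeneous d := (IsHomogeneous.rename_isHomogeneous_iff (Fin.castAdd_injective 2 2)).mp (by rw [hΨ]; exact hΦhom)
  refine ⟨Ψ, hΨhom, ?_, G - ΦG, ?_, ?_⟩
  · -- `A(Ψ) = 0`: extend `w` by zero on the `u`-letters; it lies in `A(Φ) ⊆ {v_y = 0}`
    intro w hw
    set v : Fin (2 + 2) → K := Fin.append w (fun _ : Fin 2 => (0 : K)) with hv
    have hvA : v ∈ additiveSubspace Φ := by
      rw [mem_additiveSubspace_iff_sum_smul_pderiv, Fin.sum_univ_four]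
      change v (Fin.castAdd 2 0) • pderiv (Fin.castAdd 2 0) Φ + v (Fin.castAdd 2 1) • pderiv (Fin.castAdd 2 1) Φ +
        v (u1 2) • pderiv (u1 2) Φ + v (u2 2) • pderiv (u2 2) Φ = 0
      rw [hpd _ hu1U, hpd _ hu2U, smul_zero, smul_zero, add_zero, add_zero, hv, Fin.append_left, Fin.append_left, ← hΨ,
        pderiv_rename (Fin.castAdd_injective 2 2), pderiv_rename (Fin.castAdd_injective 2 2), smul_eq_C_mul, smul_eq_C_mul,
        ← rename_C (Fin.castAdd 2) (w 0), ← rename_C (Fin.castAdd 2) (w 1), ← map_mul, ← map_mul, ← map_add, ← smul_eq_C_mul,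
        ← smul_eq_C_mul]
      rw [mem_additiveSubspace_iff_sum_smul_pderiv, Fin.sum_univ_two] at hw
      rw [hw, map_zero]
    funext k
    have h := hAV v hvA k
    rwa [hv, Fin.append_left] at h
  · -- `Q = G − in_d G ∈ 𝔪₀^{d+1}`
    rw [originIdeal_eq_idealOfVars, mem_pow_idealOfVars_iff']
    intro x hx
    rw [coeff_sub, hΦG, coeff_homogeneousComponent]
    split_ifs with hxd
    · exact sub_self _
    · have hlt : x.degree < d := by omega
      have hG : G ∈ MvPolynomial.idealOfVars (Fin 4) K ^ d := (natCast_le_ordZero_iff_mem_idealOfVars_pow G d).mp hd.symm.le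
      rw [mem_pow_idealOfVars_iff'] at hG
      rw [hG x hlt, sub_zero]
  · -- `G = Ψ(y-rows) + Q`: `σ_A (rename castAdd Ψ) = Ψ(y-rows)` and `σ_A Φ = in_d G`
    have hcompA : (linSubst K A).comp (rename (Fin.castAdd 2)) = aeval (fun k : Fin 2 => (∑ t, C (A (Fin.castAdd 2 k) t) * X t : MvPolynomial (Fin 4) K)) :=
      MvPolynomial.algHom_ext fun k => by rw [AlgHom.comp_apply, rename_X, linSubst_X, aeval_X]
    have hΨG : aeval (fun k : Fin 2 => (∑ t, C (A (Fin.castAdd 2 k) t) * X t : MvPolynomial (Fin 4) K)) Ψ = ΦG := by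
      rw [← hcompA, AlgHom.comp_apply, hΨ, hΦ, linSubst_linSubst_of_mul_eq_one hBA]
    rw [hΨG, add_sub_cancel]

end PhiLine

end Summit.ResolutionOfSingularities.ResolutionOfSingularities.Theorems.PIDim4

end
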